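import Literature.NumberTheory.EllipticCurves.LeadingTermPPartEisensteinProofs
import HarnessLib

/-!
# Keller–Yin's `p`-part of BSD at anomalous Eisenstein primes, rank `0`: what the printed inputs give

HONEST FRAMING. This file does NOT prove the `p`-part of the Birch–Swinnerton-Dyer formula at an
anomalous Eisenstein prime. It records, kernel-checked and sorry-free, the exact shape of the
deduction announced by Keller–Yin (arXiv:2402.12781v2, Thm. 3 of the Introduction = Thm. 4.2.1,
p. 22; PREPRINT, unrefereed as of 2026-08-18) in analytic rank `0`, with every published input
discharged or named and THE ONE UNPUBLISHED INPUT ISOLATED AS AN EXPLICIT HYPOTHESIS: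

> KY Thm. 4.2.1: "Let `E/ℚ` be an elliptic curve and `p > 2` a prime of good reduction. Assume that
> `E` admits a cyclic `p`-isogeny […] (equivalently, `E[p]` is reducible). Assume that
> `r_an(E) ∈ {0,1}`. Then the `p`-part of the BSD formula holds for `E/ℚ`, i.e.
> `ord_p(L^*(E,1)/(Ω_E · Reg(E/ℚ))) = ord_p(Tam(E/ℚ) · #Ш(E/ℚ)[p^∞] / (#E(ℚ)_tors)²)`."

Its printed proof (p. 22) is: "This follows from [CGLS, Thm. 5.3.1], where the use of [the
anticyclotomic main conjecture] is replaced by our Theorem 3.0.11. We remark that the assumption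
that the character is either ramified at `p` and even, or unramified at `p` and odd coming from
[GV00] is now removed by [CGS] in both the rank `0` and rank `1` formulae, and the assumption that
`φ|_{G_p} ≠ 1, ω` is removed by us." In RANK `0` the cited argument is Castella–Grossi–Skinner,
Math. Ann. 393 (2025), Thm. D (§1.2; = LaTeXML "Thm. 4" of the arXiv v1 store text
`paper:arxiv-2303.04373`, which numbers the Introduction §0), whose proof reads "In the case `r = 0`,
the argument is the same as in [CGLS, Thm. 5.1.4], replacing the appeal to [GV00] by an appeal to our
Theorem A [LaTeXML: 1]" — i.e.
Kolyvagin/Kato finiteness + Greenberg's Euler characteristic formula (LNM 1716, Thm. 4.1) +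
Mazur–Swinnerton-Dyer interpolation + MAZUR'S MAIN CONJECTURE for `(E, p)`. At an ANOMALOUS
Eisenstein prime (`a_p ≡ 1 (mod p)`, i.e. `{φ|_{G_p}, ψ|_{G_p}} = {1, ω}`) of type
(unramified, even)/(ramified, odd) — e.g. a rational `p`-torsion point at a good prime — Mazur's
main conjecture is NOT IN PRINT: Greenberg–Vatsal 2000 Thm. 1.3 needs the opposite parity type,
Castella–Grossi–Skinner 2025 Thm. A (= printed Thm. 7.1.1) needs `φ|_{G_p} ≠ 1, ω`, and Keller–Yin
prove only
ANTICYCLOTOMIC main conjectures (Thms. 1–2 = Thm. 3.0.11), asserting the cyclotomic extension in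
prose (§0.5: "would automatically generalize […] [CGS]"; likewise M. Yin, arXiv:2410.24193, §0.2).
That is the hypothesis `hMC_OPEN` below (Mazur's main conjecture for THIS `(E, p)`, Néron
normalisation, spelled exactly as in `padicValRat_bsd_rank_zero_of_mazurMainConjecture`).

What IS proved here (`bsdp_of_mazurMainConjecture_of_analyticRank_eq_zero`): for a globally minimal
`W/ℚ`, an odd prime `p` of good reduction with `a_p ≡ 1 (mod p)` (hence ordinary) and
`ord_{s=1} L(E,s) = 0`, GIVEN Mazur's main conjecture for `(E,p)` (`hMC_OPEN`), Greenberg's Thm. 4.1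
for `(E,p)` (`hGr`, inline as in the tree's rank-`0` glue; a named Literature fact is proposed
separately), modularity with an integral Manin constant (`nonempty_modularParametrizationData`) and
Gross–Zagier–Kolyvagin (`rank_eq_analyticRank_of_analyticRank_le_one`), Miller's `BSD(E,p)`
(`BSDp W p`) holds — torsion term included. Reducibility of `E[p]` is not used by the deduction
(it only locates the class), so it is not a hypothesis. The residual-class bookkeeping
(RESIDUAL-CASES.md §a.2, class X1 ∩ {r = 0}: 11a1 at 5, 14a1 at 3, 26b1 at 7, …) is in the cell
file `run/shared/lean/b2b/bsd-rank1-residual/b2b-bsdres-x1a/X1-CHAIN.md`.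

## References

* T. Keller, M. Yin, arXiv:2402.12781v2 (2024), Thm. 3 = Thm. 4.2.1 (p. 22), §0.5. [KellerYin2024]
* F. Castella, G. Grossi, C. Skinner, Math. Ann. 393 (2025) 2451–2506 = arXiv:2303.04373v2, Thm. A
  (= Thm. 7.1.1) and Thm. D (§1.2) with its proof (LaTeXML v1 store text: "Thm. 1", "Thm. 4", §0.3).
  [CastellaGrossiSkinner2025]
* F. Castella, G. Grossi, J. Lee, C. Skinner, Invent. Math. 227 (2022), Thm. 5.1.4 and its proof.
  [CastellaEtAl2021]
* R. Greenberg, V. Vatsal, Invent. Math. 142 (2000), Thms. 1.2–1.3. [GreenbergVatsal2000]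
* R. Greenberg, LNM 1716 (1999), Thm. 4.1 (p. 102). [GreenbergLNM1716]
* R. L. Miller, LMS J. Comput. Math. 14 (2011), Def. 1.1. [Miller2011LMS]
-/

set_option autoImplicit false

noncomputable section

open scoped Classical MatrixGroups ModularForm

open CongruenceSubgroup WeierstrassCurve Literature.NumberTheory.EllipticCurves
  Literature.NumberTheory.EllipticCurves.ModularForms

namespace Literature.NumberTheory.EllipticCurves.KellerYin2024

/-- An anomalous good prime is ordinary: `a_p ≡ 1 (mod p)` and `p ∤ 1` give `p ∤ a_p`. [folklore] -/
theorem not_dvd_frobeniusTrace_of_anomalous (W : WeierstrassCurve ℚ) [W.IsGloballyMinimal]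
    (p : ℕ) [Fact p.Prime] (hanom : (p : ℤ) ∣ W.frobeniusTrace p - 1) :
    ¬ (p : ℤ) ∣ W.frobeniusTrace p := by
  intro h
  have h1 : (p : ℤ) ∣ 1 := by
    have := dvd_sub h hanom
    simpa using this
  have : (p : ℤ) ≤ 1 := Int.le_of_dvd one_pos h1
  have : 1 < (p : ℤ) := by exact_mod_cast (Fact.out : p.Prime).one_lt
  omega

/-- **Keller–Yin Thm. 4.2.1 in rank `0`, from its printed inputs, with the unpublished one as a
hypothesis.** Let `W` be a globally minimal model of `E/ℚ`, `p` an odd prime of good reduction with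
`a_p(E) ≡ 1 (mod p)` (an ANOMALOUS prime; at an Eisenstein prime this is `{φ|_{G_p}, ψ|_{G_p}} = {1, ω}`,
the case excluded by Castella–Grossi–Skinner 2025 Thm. A/Thm. D and treated only by Keller–Yin), and
`ord_{s=1} L(E,s) = 0`. Assume: `hmod` (modularity with integral Manin constant, named fact),
`hGZK` (Gross–Zagier–Kolyvagin, bsd.S17, named fact), `hGr` (Greenberg, LNM 1716, Thm. 4.1 for
`(E,p)`, inline: `f_E(0) · #E(ℚ)(p)² ∼ p^{ord_p ∏ c_ℓ} · #Ẽ(𝔽_p)(p)² · #Sel_{p^∞}(E/ℚ)`), and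
`hMC_OPEN` — MAZUR'S MAIN CONJECTURE for `(E, p)` in the Néron normalisation
(`char_Λ X(E/ℚ_∞) = (ϖ · L_p(f, α))`, `ϖ · Ω_E = Ω⁺_f`), which for the anomalous Eisenstein class of
type (unramified-even)/(ramified-odd) is NOT a published theorem (Keller–Yin §0.5 and Yin
arXiv:2410.24193 §0.2 claim it in prose; Castella–Grossi–Skinner Thm. A excludes it; Greenberg–Vatsal
Thm. 1.3 covers the opposite parity type). Then Miller's `BSD(E,p)` holds:
`rank E(ℚ) = ord_{s=1} L(E,s)`, `Ш(E/ℚ)[p^∞]` finite, `#Ш_an ∈ ℚ` and `ord_p #Ш_an = ord_p #Ш[p^∞]`,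
equivalently (rank `0`) `ord_p(L(E,1)/Ω_E) = ord_p(#Ш · ∏ c_ℓ / #E(ℚ)_tors²)` — Keller–Yin's
display with `Reg = 1`. Proof = Castella–Grossi–Lee–Skinner 2022, proof of Thm. 5.1.4
(`padicValRat_bsd_rank_zero_of_mazurMainConjecture`) + Miller's remark
(`bsdp_of_padicValRat_rank_zero`); `L(E,1) ≠ 0` from `analyticRank_eq_zero_iff_holds` and the
entire continuation supplied by the newform of `hmod`.
[cite: KellerYin2024, Thm. 4.2.1 (p. 22) and its proof; §0.5]
[cite: CastellaGrossiSkinner2025, Theorem D (§1.2) and its proof, case r = 0 (arXiv v1 LaTeXML: Thm. 4, §0.3)]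
[cite: CastellaEtAl2021, Thm. 5.1.4 and its proof] -/
theorem bsdp_of_mazurMainConjecture_of_analyticRank_eq_zero
    (W : WeierstrassCurve ℚ) [W.IsElliptic] [W.IsGloballyMinimal] (p : ℕ) [Fact p.Prime]
    (hgood : W.HasGoodReductionAtPrime p) (hanom : (p : ℤ) ∣ W.frobeniusTrace p - 1)
    (hr : W.analyticRank = 0)
    (hmod : nonempty_modularParametrizationData)
    (hGZK : rank_eq_analyticRank_of_analyticRank_le_one)
    (hGr : ∀ (κ : ZpExtension ℚ p) (γ : Field.absoluteGaloisGroup ℚ),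
        κ.IsCyclotomic → κ.IsTopGenerator γ → IsCyclotomicVariable p γ →
      ∀ (D : W.SelmerDualData κ γ) [Module.Finite (IwasawaAlgebra p) D.X], D.IsTorsion →
      ∀ (fE : IwasawaAlgebra p), D.charIdeal = Ideal.span {fE} →
        Finite (W.selmerGroupPInfty p) →
        ∃ u : ℤ_[p]ˣ,
          ((PowerSeries.constantCoeff fE : ℤ_[p]) : ℚ_[p]) *
              (Nat.card (AddCommGroup.primaryComponent W.toAffine.Point p) : ℚ_[p]) ^ 2 =
            ((u : ℤ_[p]) : ℚ_[p]) * (p : ℚ_[p]) ^ (padicValNat p W.tamagawaProduct) *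
              (Nat.card (AddCommGroup.primaryComponent
                ((integralModelInt W).map (Int.castRingHom (ZMod p))).toAffine.Point p) : ℚ_[p]) ^ 2 *
              (Nat.card (W.selmerGroupPInfty p) : ℚ_[p]))
    (hMC_OPEN : ∀ (κ : ZpExtension ℚ p) (γ : Field.absoluteGaloisGroup ℚ),
        κ.IsCyclotomic → κ.IsTopGenerator γ → IsCyclotomicVariable p γ →
      ∀ [NeZero (W.conductorNorm ℤ)] (f : CuspForm (Gamma0 (W.conductorNorm ℤ)) 2),
        IsNewformOf W f → ∀ (ϖ : ℚ), (ϖ : ℝ) * W.realPeriodRat = plusPeriod f →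
      ∀ (D : W.SelmerDualData κ γ), D.IsTorsion ∧
        ∃ g : IwasawaAlgebra p, D.charIdeal = Ideal.span {g} ∧
          iwasawaToPowerSeries p g =
            PowerSeries.C (ϖ : ℚ_[p]) * padicLFunction f (unitRoot W p : ℚ_[p])) :
    BSDp W p := by
  have hord : ¬ (p : ℤ) ∣ W.frobeniusTrace p := not_dvd_frobeniusTrace_of_anomalous W p hanom
  -- `L(E,1) ≠ 0`: the newform of `E` gives the entire continuation, and `ord_{s=1} L = 0`
  haveI : NeZero (W.conductorNorm ℤ) := ⟨(W.conductorNorm_pos_holds).ne'⟩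
  obtain ⟨Dm⟩ := hmod W
  have hL : W.entireLFunction 1 ≠ 0 :=
    (analyticRank_eq_zero_iff_holds (W := W) Dm.isNewformOf.hasEntireLFunction).mp hr
  -- `Ш(E/ℚ)` finite (Gross–Zagier–Kolyvagin)
  obtain ⟨-, hfin⟩ := hGZK W (by omega)
  -- the printed shape, then Miller's `BSD(E,p)`
  exact bsdp_of_padicValRat_rank_zero W p hr hL hGZK
    (padicValRat_bsd_rank_zero_of_mazurMainConjecture W p hgood hord hL hfin hmod hGr hMC_OPEN)

end Literature.NumberTheory.EllipticCurves.KellerYin2024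

end
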